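import Summits.ResolutionOfSingularities.ResolutionOfSingularities.Theses.RisoStrata
import Summits.ResolutionOfSingularities.ResolutionOfSingularities.Theorems.RisoCentresResolve.Negative.RisoCentresResolveFalseWithoutBlowups
import Summits.ResolutionOfSingularities.ResolutionOfSingularities.Theorems.RisoCentresResolve.Negative.RisoCentresResolveFalseWithBoundedLetters

/-!
# Disproof of `RisoCentresResolve` (stmt-ResolutionOfSingularities-18546) — findings

Standing disprover's work file.  Cycle 1 (refuter-cdisprove-…-18546-0, 2026-08-17 morning): §A–§D.
Cycle 2 = generation 2 (refuter-cdisprove-…-18546-g2-0, 2026-08-17 afternoon): §E–§H.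
Crux: Monreal Q1.6 in char `p`, `∃`-schedule first-shadow form — for every projective presentation ONE
finite word `(d₁,…,d_m)` of rtd-cut blow-ups resolving every valuative local ring of every chart.
VERDICT SO FAR: **no kill**.  What is now PROVED about the statement (all kernel-checked, landed under
`Theorems/RisoCentresResolve/Negative/`):
* the tower is load-bearing — `sched = []` fails (§A1, p150373);
* the CUT LEVELS are load-bearing — no bound `D` on the letters chosen before the presentation can work,
  and no FIXED schedule works for all presentations (§G; p166775 p166782 p166968 p169092): on `cusp × 𝔸^{D+1}` the typed
  `Rtd` is `≥ D+1` at every closed point, so every letter `≤ D` has `Cen = ⊤` and is INERT;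
and what is now UNDERSTOOD (paper + exact computation, §E–§F): in characteristic `p` the typed `Rtd`
COLLAPSES to `0` along purely inseparable ("`p`-twisted") equisingular families (e.g. every point of the
singular line of `w^p = u y^p`), which merges such families into letter `0` — but in the toric sector this
never traps the process, because blowing up a reduced centre through a `p`-twisted orbit adjoins the
missing lattice points and UN-TWISTS it (model-C census + structural argument, §F).

Index (prose only in docstrings / section docs; everything conclusive is a theorem):
* §A  LOAD-BEARING ANALYSIS.  A1 `a1_false_without_blowups` (LANDED p150373).  A2–A6: dropping each
      remaining hypothesis (vacuity / no change / meaning shift) — no refutation.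
* §B  TORIC RECURRENCE CERTIFICATE (`decide`): `GL₄(ℤ)` isomorphism `T ≅` chart of `Bl_{Sing_red} T` —
      the constant top word never terminates from dimension 4 on (not a refutation: `(0,top)` resolves `T`).
* §C  COMPUTATIONAL FINDINGS of cycle 1 (models A/B): CDLL root resolved by `(top,0,top)`; > 1000
      decided toric instances, trap set always empty.
* §D  NEAR-MISS `risoCentresResolve_refuted` (sorried, this file only) — obstruction analysis, updated.
* §E  (g2) CHAR-`p` COLLAPSE OF THE TYPED `Rtd` — the Dir-calculus (necessary conditions any typed
      straightener satisfies), the umbrella `w^p = u y^p` (rtd `= 0` along the whole singular line), the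
      `A_{p-1}` check, the vertex of `T` (rtd `0` by the greedy-basis test), the twisting straightener
      (rigorous LOWER bound `f − r_p` on toric orbits) ⇒ MODEL C of the cut alphabet in char `p`.
* §F  (g2) TORIC SECTOR UNDER MODEL C: all-top ("type P") towers die at once in dims 2–3; `T`-surgery
      (lattice refinement / ray thinning / twisting generators) provably or computably fails; top
      recurrence is found ONLY in the `T` family; structural reason twists cannot persist. No trap.
* §G  (g2) BOUNDED LETTERS / FIXED SCHEDULE ARE FALSE — LANDED theorems re-exported:
      `g1_false_with_bounded_letters`, `g2_false_with_fixed_schedule` (+ the typed lower bound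
      `bddLetters_rtd` and the inert-step lemma they rest on).
* §H  (g2) What a kill would still need; next regimes.
* Targets (lead's stuck stubs): none at arming (`payload.stuck_stubs = []`); line `Sketch` stubs
      `stub_rcrSurfaceClosed` / `stub_rcrLocalUnifVeryHigh` are crux-sized open cores (not attackable by
      small models; §H records what §E–§G imply for them).
-/

set_option linter.dupNamespace false

namespace Summit.ResolutionOfSingularities.ResolutionOfSingularities.Cruxes.RisoCentresResolve.Disproof

open Summit.ResolutionOfSingularities.ResolutionOfSingularities.Theses.RisoStrata

/-! ## §A  Load-bearing analysis

A1 (theorem below). `∃ sched` cannot be witnessed by `[]`: the conclusion shape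
`IsRegularLocalRing ↥(loc O B₀)` is a genuine regularity statement about the local ring of the chart at
the centre of `O` (for `B ⊆ O`, `loc O B = B_{𝔪_O ∩ B}` literally, `s⁻¹ ∈ O ∧ s ∈ B ⊆ O` meaning `s` is an
`O`-unit or `s = 0`, the latter contributing only `a·0⁻¹ = 0`).

A2. Drop `¬ IsRegularLocalRing (Localization …)` from `Cen` (centres through ALL low-rtd points, regular
ones included): then for `d ≥` the embedding dimension every closed point qualifies
(`rtd_le_of_span_sup_sq_eq`, tree), `Cen B d = ⋂ (all maximal ideals) = 0` in the `k`-domain `B`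
(Jacobson, infinitely many maximal ideals), `Valid` demands a NONZERO `x ∈ Cen` — unsatisfiable — and the
crux becomes VACUOUSLY TRUE for any schedule containing such a `d`.  Moral: the singular-only restriction
is what keeps admissible chart paths in existence; it is not droppable "for free" in a proof either
(a proof that never uses singularity of the centre points proves the vacuous variant).

A3. Drop `IsAlgClosed k`: maximal ideals with residue field `≠ k` admit no generating tuple inside `m`
(`k[g]/(g) = k`), so `Rtd B m r` is false for every `r` there and such points sit in every `Z_d`; the
statement changes meaning (Galois-conjugate points are blown up as reduced closed subschemes) but no
cheap falsity appears (curves still resolve).  Not refuted; recorded as meaning-shift.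

A4. Drop the `O`-minimality clause `∀ a' ∈ Cen B d, a'·x_t⁻¹ ∈ O` of `Valid`: then `B_{t+1} ⊄ O` is
allowed and `loc O B_{t+1}` is no longer a local ring of the blow-up at the centre of `O` (it contains
`s⁻¹` for every `s ∉ O`); the statement then quantifies over charts not containing the centre — a
different (and presumably false) statement; not pursued (the clause is plainly intended).

A5. `∀ c : k, algebraMap k K c ∈ O` is REDUNDANT whenever `k` is algebraic over `𝔽_p` (e.g. `k = 𝔽̄_p`:
every valuation is trivial on torsion units) but NOT in general (`k = \overline{𝔽_p(u)}` carries
valuations non-trivial on `k`); provers may not drop it.  `p.Prime`/`CharP k p`: decorative for falsity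
(the characteristic-0 analogue is Monreal's printed open question; `p = 1` is vacuous, `p = 0` open).

A6. Quantifier order `∃ sched ∀ O ∀ j ∀ x` vs `∀ O ∃ sched` (riso-constrained local uniformization): the
weaker form is implied and equally unrefuted; the gap between them is exactly "synchronizing word vs.
pointwise termination" (§C): on every computed automaton both hold or both fail.
-/

/-- **§A1 (LANDED as `Theorems.risoCentresResolve_false_without_blowups`, proposal p150373, commit
6979458aba67, file `Theorems/RisoCentresResolve/Negative/RisoCentresResolveFalseWithoutBlowups.lean`).**
The crux `RisoStrata.RisoCentresResolve` with its existential `∃ sched : List ℕ,` replaced by the fixed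
empty schedule `let sched : List ℕ := [];`, everything else verbatim, is FALSE: for the cuspidal
presentation `h = (1, X², X³)` of `k(X)` (`k = 𝔽₂^alg`, chart `j = 0`, `B₀ = k[1,X²,X³]`) and the `X`-adic
valuation ring `O`, `loc O B₀ = k[X²,X³]_{(X²,X³)}` is not regular (regular ⇒ integrally closed, tree
Matsumura 19.4; `(X³/X²)² = X²` but `X ∉ loc O B₀` by the functional `f ↦ f'(0)`).  Any proof of the
crux must therefore blow up (produce a non-empty schedule) on some presentation; the conclusion shape is
not vacuous. [folklore] -/
theorem a1_false_without_blowups : ¬ (∀ p : ℕ, p.Prime → ∀ (k : Type) [Field k] [CharP k p] [IsAlgClosed k] (K : Type) [Field K] [Algebra k K] (N : ℕ) (h : Fin (N + 1) → K), (∀ i, h i ≠ 0) → IntermediateField.adjoin k (Set.range fun ij : Fin (N + 1) × Fin (N + 1) => h ij.1 * (h ij.2)⁻¹) = ⊤ → let Arc : ∀ (B : Subalgebra k K), Ideal ↥B → Type := fun B m => {α : ↥B →ₐ[k] HahnSeries ℚ k // ∀ b ∈ m, 0 < (α b).orderTop}; let Rtd : ∀ (B : Subalgebra k K), Ideal ↥B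 → ℕ → Prop := fun B m r => ∃ (n : ℕ) (g : Fin n → ↥B), (∀ i, g i ∈ m) ∧ Algebra.adjoin k (Set.range fun i => (g i : K)) = B ∧ ∃ W : Submodule k (Fin n → k), r ≤ Module.finrank k ↥W ∧ ∃ φ : Arc B m → (Fin n → HahnSeries ℚ k), (∀ a b : Arc B m, a ≠ b → ∃ j, ∀ i, (a.1 (g j) - b.1 (g j)).orderTop < ((φ a i - φ b i) - (a.1 (g i) - b.1 (g i))).orderTop) ∧ (∀ a i, 0 < (φ a i).orderTop) ∧ (∀ a, ∀ w : Fin n → HahnSeries ℚ k, (∀ i, 0 < (w i).orderTop) → w ∈ Submodule.span (HahnSeries ℚ k) ((fun u : Fin n → k => fun i => HahnSeries.C (u i)) '' (W : Set (Fin n → k))) → ∃ b, φ b = φ a + w); let Cen : ∀ (B : Subalgebra k K), ℕ → Ideal ↥B := fun B d => ⨅ m ∈ {m : Ideal ↥B | ∃ hm : m.IsMaximal, ¬ IsRegularLocalRing (Localization (@Ideal.primeCompl ↥B _ m hm.isPrime)) ∧ ¬ Rtd B m (d + 1)}, m; let step : Subalgebra k K → ℕ → K → Subalgebra k K := fun B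 d xt => Algebra.adjoin k ((B : Set K) ∪ {y | ∃ a ∈ Cen B d, y = (a : K) * xt⁻¹}); let Valid : ValuationSubring K → Subalgebra k K → ℕ → K → Prop := fun O B d xt => xt ≠ 0 ∧ (∃ x ∈ Cen B d, (x : K) = xt) ∧ ∀ a' ∈ Cen B d, (a' : K) * xt⁻¹ ∈ O; let stage : Subalgebra k K → List ℕ → (ℕ → K) → ℕ → Subalgebra k K := fun B₀ sched x t => ((sched.take t).zipIdx).foldl (fun B de => step B de.1 (x de.2)) B₀; let loc : ValuationSubring K → Subalgebra k K → Subalgebra k K := fun O B => Algebra.adjoin k {y | ∃ a ∈ B, ∃ s ∈ B, s⁻¹ ∈ O ∧ y = a * s⁻¹}; let sched : List ℕ := []; ∀ O : ValuationSubring K, (∀ c : k, algebraMap k K c ∈ O) → ∀ j : Fin (N + 1), (∀ i, h i * (h j)⁻¹ ∈ O) → ∀ x : ℕ → K, (∀ t, t < sched.length → Valid O (stage (Algebra.adjoin k (Set.range fun i => h i * (h j)⁻¹)) sched x t) (sched.getD t 0) (x t)) → IsRegularLocalRing ↥(loc O (stage (Algebra.adjoin k (Set.range fun i => h i * (h j)⁻¹))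 sched x sched.length))) :=
  Summit.ResolutionOfSingularities.ResolutionOfSingularities.Theorems.risoCentresResolve_false_without_blowups

/-! ## §B  The dimension-4 toric recurrence — kernel-checked certificate

Dictionary (intended semantics; NOT typed against the crux's Hahn-series `Rtd`): for an affine semigroup
`S ⊂ ℤ⁴` with `ℤS = ℤ⁴`, `k[S] ⊂ K = k(t₁,…,t₄)` is a chart `B`; its singular closed points form a union
of torus-orbit closures (the typed `Rtd` is invariant under the torus because `k`-algebra automorphisms
of `B` extending to `K` transport presentations, arcs and straighteners), so every centre `Z_d` is a
reduced union of orbit closures `V(p_F)`, `F` a face of `cone(S)`, with monomial radical ideal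
`I = k{u ∈ S : u ∉ ⋃F}`; the blow-up charts are `k[S + ℕ{b_j − b_i}]` over the minimal generators `b_i`
of `I`.  For the TOP letter (`d ≥` embedding dimension, all singular points) no rtd model is needed.
`T = k[S_T]`, `S_T = ℕ⟨tGen 0, …, tGen 6⟩` (below), has `Sing T = V(e₃) ∪ V(e₁) ∪ V((1,2,-1,-1))` (three
curves, transversal type the conifold), `I = (g₁, g₂, g₄, g₆, g₃+g₅, g₃+g₇, g₅+g₇)` and the chart at
`g₁` is generated by `tChart 0, …, tChart 6`; `tU ∈ GL₄(ℤ)` (inverse `tUinv`) maps `{tGen i}` onto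
`{tChart j}`, so the chart is isomorphic to `T` and the tower of top-letter blow-ups contains a copy of
`T` at every stage (never regular), in every characteristic.  Source: ideator-2 workfile
`Cruxes/RisoCentresResolve/ToricRecurrenceDim4.md`; independently recomputed by `toric/toric.py`
(same matrix found by the engine's isomorphism search).  `T` itself is resolved by the word `(0, top)`.
-/

/-- The seven generators `g₁,…,g₇` of the affine semigroup `S_T ⊂ ℤ⁴` of the toric fourfold `T`. -/
def tGen : Fin 7 → Fin 4 → ℤ :=
  ![![0, -1, 1, 1], ![0, 0, 0, 1], ![0, 0, 1, 0], ![0, 1, 0, 0], ![1, 0, 0, 0], ![1, 1, -1, 0],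
    ![1, 2, -1, -1]]

/-- The seven generators of the chart at `g₁` of `Bl_{(Sing T)_red} T`:
`g₁, g₃, g₂−g₁, g₄−g₁, g₅, g₃+g₅−g₁, g₆−g₁`. -/
def tChart : Fin 7 → Fin 4 → ℤ :=
  ![![0, -1, 1, 1], ![0, 0, 1, 0], ![0, 1, -1, 0], ![0, 2, -1, -1], ![1, 0, 0, 0], ![1, 1, 0, -1],
    ![1, 2, -2, -1]]

/-- The recurrence matrix `U` (acting on column vectors). -/
def tU : Matrix (Fin 4) (Fin 4) ℤ := !![1, 0, 0, 0; 1, 1, 2, -1; 0, -1, -1, 1; -1, 0, -1, 1]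

/-- Its integer inverse. -/
def tUinv : Matrix (Fin 4) (Fin 4) ℤ := !![1, 0, 0, 0; 1, 0, -1, 1; -1, 1, 1, 0; 0, 1, 1, 1]

/-- `U` is unimodular: `U · U⁻¹ = 1`. -/
theorem tU_mul_tUinv : tU * tUinv = 1 := by decide

/-- `U` is unimodular: `U⁻¹ · U = 1`. -/
theorem tUinv_mul_tU : tUinv * tU = 1 := by decide

/-- The chart generators are the listed differences of `S_T`-generators (so they do generate
`S_T + ℕ{b − g₁ : b ∈ I}` together with `S_T`, whose remaining generators are sums of these:
`g₂ = (g₂−g₁)+g₁`, `g₄ = (g₄−g₁)+g₁`, `g₆ = (g₆−g₁)+g₁`, `g₇ = (g₆−g₁)+g₃`). -/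
theorem tChart_eq : tChart 0 = tGen 0 ∧ tChart 1 = tGen 2 ∧ tChart 2 = tGen 1 - tGen 0 ∧
    tChart 3 = tGen 3 - tGen 0 ∧ tChart 4 = tGen 4 ∧ tChart 5 = tGen 2 + tGen 4 - tGen 0 ∧
    tChart 6 = tGen 5 - tGen 0 ∧ tGen 6 = tChart 6 + tGen 2 := by decide

/-- **Recurrence certificate**: `U` maps the generator set of `S_T` INTO the generator set of the chart … -/
theorem tU_mulVec_mem : ∀ i : Fin 7, ∃ j : Fin 7, tU.mulVec (tGen i) = tChart j := by decide

/-- … and ONTO it; with `tU_mul_tUinv` this is a `GL₄(ℤ)`-isomorphism of affine semigroups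
`S_T ≅ S_chart`, i.e. of the toric varieties `T ≅ (chart at g₁ of Bl_{(Sing T)_red} T)`. -/
theorem tU_mulVec_surj : ∀ j : Fin 7, ∃ i : Fin 7, tU.mulVec (tGen i) = tChart j := by decide

/-! ## §C  Computational findings (exact integer arithmetic; `toric/` in the session folder)

Engine `toric/toric.py` (faces by facet enumeration; regularity along an orbit `O_F` ⇔ the transversal
monoid `(S + ℤ(S∩F))/ℤ(S∩F)` — torsion kept — has `n − dim F` irreducibles; centres = monomials outside
the selected faces, minimal generators over minimal non-faces; charts `S + ℕ{b_j − b_i}`; `GL_n(ℤ)` iso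
test), two rtd models for sub-top letters: A `rtd(O_F) = dim F` (ideator 2's), B `= dim F + #free
factors of the transversal monoid` (product-structure lower bound).  Search `toric/search.py`: lazy
best-first synchronizing-word search + greatest-fixed-point TRAP check (a set of chart classes closed
under every letter = certificate that NO schedule resolves, modulo the rtd model; with the top letter
model-free).
* `T`: 2 classes (`T`, `U` = 5-generator chart); `T —0→ {U}`, `T —top→ {T,U}`, `U —0→ {U}`, `U —top→ ∅`:
  synchronizing word `(0, top)`; constant words fail (as ideator 2 found).
* CDLL root `X(S)` (`S = cone(h₁..h₆) ∩ ℤ⁴`, Hilbert basis `h₁..h₇`; `Sing` = three surfaces, transversal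
  `A₂` resp. `⅓(1,1)`): top letter → 5 charts, 2 singular (`T` and a 5-generator hypersurface) — matches
  the workfile; **word `(top, 0, top)` RESOLVES `X(S)`** (after `0`: 4 singular charts, 8 regular; after
  the final `top`: 16 regular charts, none singular), in BOTH rtd models (also `(top,0,0,top)`,
  `(0,top,0,top)`); `(0,1)` leaves 29 singular charts (= ideator 2's count), `(top)⁴` leaves 54,
  `(1,0,1)` 174.  So the "open root" of `synchronizing-word-automaton.md` is synchronizable: threat retired.
* CENSUSES (kit job j023911, outputs attached to the item as `compute-j023911.json`; engine as above, per
  instance best-first search ≤ 48 s per rtd model + BFS trap check): normal affine toric THREEFOLDS (random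
  cones, ≤ 12 Hilbert-basis generators, coordinates ≤ 4): 200/200 synchronizable in both models (words of
  length ≤ 12, mean 2.9); normal FOURFOLDS: 520 instances (coords ≤ 3 resp. ≤ 2): model B 490 synchronizable
  within budget (words ≤ 11, mean 3.7), model A 470; the 30 B-undecided were ALL search timeouts (no closed
  alive set) and a local re-run with the 4×-faster engine resolves 15 of them within 25 s by words of length
  6–13 (e.g. `#56`: `(2,3,3,2,0,3,0,1,3,3,3,3,3)`), the rest are re-queued with 240 s budgets (kit
  j025182–j025185; further censuses j025186–j025187: dim 5 normal, dim 4 non-normal, dim 3).  Non-normal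
  random fourfolds (71 done before the wall cap): 23 synchronizable, 48 timeouts (deep codimension-1 cusps,
  long words), 0 traps.  Local: dim 2 non-normal 12/12 (words ≤ 12), dim 3 non-normal 16/16, products
  (umbrella², umbrella×A₁, cusp³, umbrella×cusp², T×cusp in dim 5: word `(top,1,2)`) all synchronizable.
  **In > 1 000 decided instances the TRAP SET WAS ALWAYS EMPTY: no affine toric variety with an
  unsynchronizable cut automaton (= a counterexample to the crux modulo the rtd model) has been found.**
  Independent regularity re-check of the 23 final charts of `(top,0,top)` on `X(S)`: each is `𝔸^a × 𝔾_m^b`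
  (`#non-unit generators = 4 − rk(units)`, lattice index 1).
Caveat (recorded for the next seat): the trap search is sound only relative to the alphabet it
enumerates; a model-free refutation in the toric sector would need a trap against ALL torus-invariant
reduced centres nested by some orbit function — none seen.
-/

/-! ## §E  (generation 2) The characteristic-`p` collapse of the typed `Rtd` — Dir-calculus

Notation: `𝔪 ⊂ k⟦t^ℚ⟧` the series of positive order; for a chart `B = k[g₁,…,g_n]` (`gᵢ ∈ m`) the arcs
centred at `m` are the points `x = (a(gᵢ))ᵢ ∈ X(𝔪) ⊂ 𝔪ⁿ`; for `x ∈ X(𝔪)` and `γ ∈ ℚ_{>0}` put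
`Dir_γ(X,x) := {lc_γ(y − x) : y ∈ X(𝔪), v(y − x) = γ} ⊂ kⁿ` (leading-coefficient vectors at level `γ`).
FACTS (paper, each a few lines from the three clauses of the typed `Rtd`; the generating tuple may be
changed at the cost of an injective linear map on the Zariski tangent space, so everything below is
intrinsic):
* (E1) a typed risometry `φ` (clause 1: `v((φx−φy) − (x−y)) > v(x−y)`) is a bijection onto its image
  preserving `Dir_γ` at corresponding points: `Dir_γ(φX, φx) = Dir_γ(X, x)` for all `γ`;
* (E2) clause 3 (translation of the image by `𝔪·W`) then gives, for `0 ≠ W ∈ W` and EVERY arc `x` and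
  EVERY `c ∈ 𝔪`, an arc `y = x + cW + o(c)` with `Dir_•(X, y) = Dir_•(X, x)` (all levels); in particular
  (E2a) `W ∈ Dir_γ(X, x)` for all `x, γ` ("first-order realisability at every arc at every scale"),
  (E2b) `W ∈ in(T_x X)` for every arc `x` that is a smooth `K`-point (fine scales: `Dir_γ → in(T_x X)`,
  the initial space of the embedded tangent space), (E2c) `W ∈ Dir_γ(X, x₀)` at the constant arc `x₀`
  (the tropical initial data of the germ), (E2d) transport of the whole `Dir`-profile along `x ↦ y`.
CONSEQUENCES.
* (E3) UMBRELLA `w^p = u y^p` (`B = k[x^p, y, xy] ⊂ k(x,y)`, all `p`): at ANY point of the singular line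
  (all isomorphic to the origin by `u ↦ u − c, w ↦ w − c^{1/p} y`) the profile of an arc with `v(y₀) = β`
  is: `Dir_γ = (u,y)`-plane for `γ < pβ/(p−1)`, `(y,w)`-plane for `γ > pβ/(p−1)`; (E2a) forces `W ∥ ∂_y`,
  and (E2d) with `v(c) < β` changes `β` hence the switching level — contradiction.  So typed
  `rtd = 0` along the whole singular line (the lead c2's observation, re-derived independently), while in
  characteristic `0` the analogous family `w^n = u y^n`, `u ≠ 0`, is étale-locally a product (`rtd ≥ 1`).
  Letter `0` therefore blows up this CURVE in char `p`.
* (E4) SANITY `A_{p−1}`: `z^p = xy` in char `p` has `∂_z ∈ T_x X` at every smooth point and passes (E2b),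
  (E2c) (for `p ≥ 3`), but FAILS (E2a) at deep arcs for shallow `c` ((p−1)v(c) ≤ min(v x, v y)) — typed
  `rtd = 0` at the `A_{p−1}` point, as intended: the tests are sharp enough to tell these apart.
* (E5) VERTEX OF `T` (any `p`): for the torus chart `X = Spec k[S] ⊂ 𝔸^{gens}`,
  `in(T_x X) = in_w(rowspace(gens mod p)) · diag(c^{g})`, so (E2b) over all weights `w = ⟨ω, g⟩`
  (`ω ∈ int σ^∨`) and all torus scalings leaves `supp W ⊆ ⋂_ω GreedyBasis_ω(gens mod p)`; for `T` this
  intersection is EMPTY over the 84 realisable weight orders for `p = 2,3,5,7` (engine `greedy.py`):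
  typed `rtd(vertex of T) = 0`.  Dually the TWISTING STRAIGHTENER (rigorous typed LOWER bound; the
  construction formalises like `bddLetters_rtd`): for a face `F` with `G = ℤ(S ∩ F)` and any
  `π ∈ (ℤⁿ)^*` with `π(G) ⊄ pℤ`, `a ↦ (λ, λ⁻¹·a)`, `λ = a(χ^{u₀})` (`π(u₀)` prime to `p`), straightens one
  direction: `rtd(O_F) ≥ f − r_p(F)`, `r_p` = `p`-rank of `sat(G)/G` (`= f` for saturated `G`, so the
  three conifold curves of `T` have typed `rtd ≥ 1` and `T` IS resolved by `(0, top)` in typed semantics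
  — `T` stays dead for disproof).
* (E6) MODEL C (char `p` cut alphabet on a toric chart): `rtd(O_F) = (f − r_p(F)) + a(F)`, `a(F)` = number
  of free `𝔸¹`-factors of the transversal monoid computed WITH its torsion (`r_p = f` ⇔ all generators on
  `F` lie in `p·ℤⁿ` ⇔ `rtd = a(F)`, usually `0`).  Lower bound rigorous (E5); upper bound = (E2)-tests,
  verified on the umbrella, `A_{p−1}`, the `T` vertex; used below as the search model.

## §F  (generation 2) The toric sector under model C — engine `engine/{toric,automaton,toprec}.py`
(exact integer arithmetic; session folder of refuter-cdisprove-…-18546-g2-0; validated by reproducing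
the §B certificate: same facets, `Sing T`, `J`, and the SAME matrix `tU` found by the isomorphism search)

* (F1) ALL-TOP TOWERS ("type P": every singular positive-dimensional face has all its generators in
  `pℤⁿ`, so every letter is the top letter): dim 2 — 97/97 sampled roots resolve or leave type P at once
  (58 fully resolved inside type P, e.g. `⟨(2,0),(0,2),(1,1),(2,1)⟩ → ⟨(0,2),(1,0),(1,1)⟩` (umbrella) →
  regular); dim 3 — of 33 admissible roots 3 resolve inside type P and 30 acquire a chart with an honest
  (saturated) singular face after ONE blow-up.  No type-P cycle exists in the samples (dims 2–3, `p = 2`).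
* (F2) `T`-SURGERY IS PROVABLY USELESS: refining the lattice to make `g₃,g₅,g₇` `p`-divisible makes every
  2-face through them non-saturated (twist spreads ⇒ `L = p⁻¹ℤ⁴`, i.e. `T` again); thinning the rays
  (`S ∩ ρᵢ ↦ pℕgᵢ`) keeps the cone, the singular faces and `J` but the chart of `Bl_J` at `g₁` CONTAINS
  `gᵢ = (g₁+gᵢ) − g₁` again — the blow-up un-thins; replacing generators `gᵢ ↦ p gᵢ` (subsets of the
  seven generators, `p = 2`, table `engine/twistT_p2.log`): the top tower either resolves within ≤ 5
  classes or falls back onto `T` itself — no new recurrent class appears.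
* (F3) TOP RECURRENCE (model-free) is found ONLY in the `T` family: perturbations of `T` recur through
  classes isomorphic to `T`; random dim-3 "hypersurface" semigroups: 100/105 singular roots fully resolved
  by the top word within budget, 5 open by budget, 0 cycles.  (Cycle-1 censuses, §C: same picture in
  dims 2–5.)  `T` IS AN ATTRACTOR: in the dim-4 census (kit job j026757, random roots in `[-2,2]⁴`, NOT
  seeded near `T`) the only top cycles found run from the random root INTO a class `≅ T` — e.g. root
  `⟨(-2,-2,1,1),(-2,-1,-1,-2),(-2,2,0,0),(-1,-2,2,2),(-1,-1,1,0),(-1,0,-2,1)⟩` reaches the self-recurrent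
  class `⟨(-1,0,-3,2),(-1,1,-4,0),(-1,2,-4,-1),(0,-1,1,1),(0,0,0,-1),(0,0,1,0),(0,1,0,-2)⟩ = U·T` with
  `U = [[-1,0,-1,0],[2,-1,0,0],[-4,1,-3,0],[-1,1,2,-1]] ∈ GL₄(ℤ)`, and root
  `⟨(-2,-1,2,1),(0,-2,-2,-1),(1,1,-2,0),(1,2,-1,0),(2,0,-2,2),(2,0,2,2)⟩` likewise (`U =
  [[0,1,0,-1],[3,0,2,-4],[-6,-2,-20,11],[-4,-1,-13,7]]`).  Since any trap of the cut automaton contains an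
  infinite TOP path, traps can only live where top recurrence lives, and there (the `T` family) all
  singular curves are saturated (E5) — model C = A, and `(0,top)` resolves.
* (F4) STRUCTURAL REASON twists do not persist: if `O_F` is `p`-twisted and `b ∈ J` with `b + v ∈ S` for a
  missing face point `v ∈ sat(G) ∖ G`, the chart of `Bl_J` at `b` contains `v`; along the followed chart
  the index of `G` drops, and new singular rays of a chart are spanned by differences `b' − b` of centre
  generators, generically primitive.  The collapse therefore changes WHICH letter acts (coarser alphabet
  on twisted charts) but not whether some word terminates, in every toric instance examined.
VERDICT of §E–§F: the one place where typed and intended semantics diverge in char `p` does not yield a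
toric counterexample; a non-toric one would need a germ whose `p`-twisted singular family REPRODUCES a
`p`-twisted family under the blow-up of its own closure (the umbrella family `w^p = u y^{kp}` loses one
`p` from the exponent per step; `w^p = u y^p + v z^p` resolves in one step) — none found.
-/

/-! ## §G  (generation 2) Bounded letters and fixed schedules are FALSE — landed theorems

`Theorems/RisoCentresResolve/Negative/RisoCentresResolveFalseWithBoundedLetters.lean` (p169092; supports
`…BddLettersHahn` p166775, `…BddLettersRtd` p166968, `…BddLettersInert` p166782), generation 2.  The mechanism is a typed LOWER
bound, the first one in the tree beyond the affine line: on `B₀ = k[T²,T³,z₀..z_D]` (`cusp × 𝔸^{D+1}`)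
`Rtd B₀ m r` holds for EVERY maximal `m` and every `r ≤ D+1` (`bddLetters_rtd`: identity straightener,
`W` = the `z`-directions, translated arcs by re-evaluating `k[x,z] ⊇ B₀` at `(x, a z + w)`), hence for
`d ≤ D` the filter `{m singular, ¬Rtd m (d+1)}` is EMPTY, `Cen_d = ⊤`, the admissible choice `x_t = 1`
makes the step the identity (`bddLetters_foldl_fixed`), and at the `T`-adic valuation of `k'(T)`
(`k' = Frac k[z]`) the end ring is the non-regular cusp over `k'` (`bddLetters_not_regular`).
READING FOR PROVERS: (i) the schedule's letters must reach the dimension of the top equisingular PRODUCT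
strata of the presentation — below it a letter is a no-op, not a point blow-up; (ii) combined with the
lead's lazy-height-one theorem (WLOG infinitely many top letters) the live alphabet for a presentation of
dimension `n` is `{0,…,n−1} ∪ {top}` with the LOW letters meaningful only on strata of riso-dimension
exactly `d`; (iii) there is no universal word, so `∃ sched` must genuinely be produced from the
presentation (no compactness over presentations). -/

/-- **§G1 (LANDED, `Theorems.risoCentresResolve_false_with_bounded_letters`).** The crux with
`∃ sched` weakened to `∃ sched, (∀ d ∈ sched, d ≤ D) ∧ …` for a bound `D` fixed before the presentation
is false (witness `cusp × 𝔸^{D+1}`). -/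
alias g1_false_with_bounded_letters :=
  Summit.ResolutionOfSingularities.ResolutionOfSingularities.Theorems.risoCentresResolve_false_with_bounded_letters

/-- **§G2 (LANDED, `Theorems.risoCentresResolve_false_with_fixed_schedule`).** For every fixed
`s : List ℕ` the crux with `let sched := s` is false — no universal word; `s = []` is §A1. -/
alias g2_false_with_fixed_schedule :=
  Summit.ResolutionOfSingularities.ResolutionOfSingularities.Theorems.risoCentresResolve_false_with_fixed_schedule

/-! ## §D  Near-miss: the crux itself -/

/-- NEAR-MISS (not closed; `sorry` permitted only in this work file).  Why `RisoCentresResolve` resists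
refutation in cycle 1:
1. ENCODING IS FAITHFUL (third independent audit): `loc O B_t` is literally the local ring at the centre
   (`B_t ⊆ O` inductively via `Valid`); `Cen ≠ 0` and finite generation give admissible `x_t` for EVERY
   `O` (no vacuity); `Cen = ⊤` steps are harmless localisations; `O = K` gives a field (regular);
   appending letters never hurts (regular centre ⇒ `Cen ⊄ 𝔪_O ∩ B` ⇒ the step is a localisation at an
   `O`-unit); typed `Rtd ≤ edim` (tree) makes every `d ≥ edim` the top letter `Sing_red`; torus/automorphism
   invariance of `Rtd` makes toric centres orbit-closure unions.  No junk model, no degenerate parameter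
   (`N = 0 ⇒ K = k`; `sched = []` false but not claimed) falsifies it.
2. INTENDED STATEMENT IS OPEN-PROBLEM HARD, and every classical killer of memoryless rules dies only under
   CONSTANT words: pinch point (`0^*` loops, `top` wins), Kollár 3.6.2 `x²+y²+z^m t^m` (`0^*` loops —
   Kollár's Claim 3.6.3 is smooth-centre only, p.113 — `top^{⌈m/2⌉+1}` wins), Lipman's `z²+x³+y⁷`
   (`top³` wins without normalising), `Ẽ₈`, toric `T` (`top^*` AND `0^*` loop, `(0,top)` wins), CDLL
   `X(S)` (`(top,0,top)` wins).  A kill needs an IMMORTAL FAMILY: finitely many germ types closed under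
   EVERY letter (each letter recreating a member over each member) — equivalently a trap of the cut
   automaton; none exists in the censused toric sector (§C), and outside it each letter costs a Rees
   algebra + singular-locus + rtd computation per chart (no CAS on the hub; kit has sympy only).
3. A LEAN kill additionally needs typed `Rtd` values at the recurring points (only `Rtd ≥ 1` on the
   affine line and `Rtd ≤ edim` are in the tree) — out of reach this cycle even given an immortal family,
   unless the family is immortal under the top letter ALONE plus all coarser-than-needed letters, where
   `Rtd` enters only through `Rtd ≤ edim`.
Next regimes (for a re-armed seat): (i) trap search against the FULL torus-invariant alphabet on
dims 4–5 normal cones with ≥ 7 rays (job template `toric/job1`); (ii) non-toric quasi-homogeneous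
fourfolds `x²+y²+z^a t^b w^c`-type where `Sing` has ≥ 2 strata of equal dimension; (iii) THE TYPED-`Rtd`
DICHOTOMY ON `T` (sharpest "hidden lemma" found this cycle).  Along the three singular curves of `T`
typed `Rtd ≥ 1` HOLDS by an explicit straightener (sketch, not yet formalised): at a closed point of the
orbit of the ray `ℝ₊e₃` the monomial `t₃` is an `O`-unit `c + ε_α` on every arc `α`; twisting the monoid
map `u ↦ α(χᵘ)` by `λ^{u₃}` (`λ = 1 + w/α(t₃)`) is again an arc, and `φ(α)_j := α(χ^{g_j})·(α(t₃)/c)^{-(g_j)₃}`,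
`φ(α)₃ := α(t₃) − c` is a risometry (errors carry an extra factor of positive order) whose image is
invariant under translating the `t₃ − c` coordinate — clauses (1)–(3) of `Rtd B m 1`.  Hence on the
presentation `h = (1, χ^{g₁},…,χ^{g₇})` of `k(t₁,…,t₄)` (chart `B₀ = k[S_T] = T`) the letters of the crux
separate the vertex from the curves IFF typed `Rtd(vertex) = 0`, i.e. `¬ Rtd T 𝔪_v 1`.  If that upper
bound FAILED (a straightener at the vertex), every letter would act on `T` as `top` or not at all, the
`top`-recurrence of §B would run along a valuation centred at the vertex of the recurring copy (charts
increase, `Valid` holds, `loc` = the vertex local ring, singular), and `RisoCentresResolve` would be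
FALSE.  So ANY PROOF of the crux proves the non-existence statement `¬ Rtd T 𝔪_v 1` (typed Monreal
Thm 1.2 at a toric vertex with stabiliser-free tangent cone) — provers: this is the concrete instance of
the "hidden lemma `Rtd ≤ dim Stab(C_x)`" on which the toric sector turns; refuters: a typed straightener
at the vertex of `T` would be an unconditional kill.  More generally the true cut alphabet is sandwiched:
`rtd_true ≥ rtd_B ≥ rtd_A` orbitwise (twisting lower bounds), so the words `(0,top)` for `T` and
`(top,0,top)` for `X(S)` are valid in the typed semantics exactly when typed `Rtd` vanishes at the singular
fixed points met along the way.
4. (generation 2) The dichotomy of item 3 is SETTLED in favour of the crux: typed `rtd(vertex of T) = 0`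
   (greedy-basis test, §E5) and typed `rtd ≥ 1` on its saturated curves (twisting straightener, §E5), so
   `T` is resolved by `(0, top)` in the typed semantics too.  The genuinely new char-`p` phenomenon — the
   COLLAPSE `rtd = 0` along `p`-twisted families (§E3) — coarsens the alphabet but, in the toric sector,
   never traps (§F: twists are undone by the blow-ups they trigger).  What a kill needs NOW (§H): a germ
   with a `p`-twisted singular family that reproduces a `p`-twisted family under the blow-up of its own
   closure AND whose other strata give no separating letter; or an intended-semantics counterexample to
   Monreal Q1.6-with-unions itself (open).  Neither is in sight; the bounded-letter / fixed-schedule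
   weakenings ARE false (§G), which is the sharpest unconditional negative statement obtained. -/
theorem risoCentresResolve_refuted : ¬ RisoCentresResolve := by
  sorry

/-! ## §H  (generation 2) What a kill would still need; next regimes for a re-armed seat
1. NON-TORIC TWIST REPRODUCTION: search quasi-homogeneous `p`-cyclic covers `w^p = F(u, y, z, …)` with
   `∇F` vanishing on a positive-dimensional set `Z` (twisted singular family), such that a chart of
   `Bl_{Z_red}` is again of this form with `dim Z' = dim Z` (the umbrella-type families strictly decrease a
   discrete invariant; a reproduction needs `F` whose strict transform regenerates the coefficient).  Tool:
   sympy Gröbner on kit (one batched job), alphabet by model C extended with (E2)-tests at the new strata.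
2. TYPED UPPER BOUNDS IN LEAN (needed by ANY refutation through the collapse and equally by the provers'
   surface engine): formalise (E1)–(E2a) for the crux's inline `Rtd` (pure valuation bookkeeping on
   `HahnSeries ℚ k`, no `p`-th roots needed for (E2a)), then (E3) needs Frobenius-surjectivity on
   `k⟦t^ℚ⟧` over perfect `k`.  `bddLetters_rtd` shows the clause-3 arc constructions are tractable.
3. INTENDED-SEMANTICS ATTACK (char-free): the cut automaton of NON-normal fourfolds with codimension-1
   singularities timed out in 48/71 cycle-1 instances; the g2 engine (`toprec.py`, class-graph cycle
   detection; kit j026757, dims 3–5, box/mixed/pos/hyper generators) finds top recurrence in dim 4 only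
   through classes `≅ T` (§F3) — extend the census to `p = 3, 5` letters and to 8–9 generators before
   declaring the toric sector closed.
4. NEXT CONCRETE NEGATIVE LEMMA (the `Rtd` filter is load-bearing — "pure `Sing_red` blow-ups do not
   resolve"): the crux with `Cen B d := ⨅ m ∈ {m | ∃ hm : m.IsMaximal, ¬ IsRegularLocalRing B_m}, m`
   (the `¬ Rtd B m (d+1)` conjunct dropped, so only `sched.length` matters) is FALSE, witnessed by `T`
   (§B): the chart `U·T` of `Bl_{Sing_red} T` is `≅ T` with vertex over vertex, so a valuation `O`
   dominating `⋃_t (B_t)_{vertex}` with `x_t :=` the recurring monomial generator of `J_t` is admissible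
   at every stage and `loc O B_m ≅ k[T]_{vertex}` is never regular.  Typed glue still to write (est.
   1.5–3 kloc): affine semigroup algebras as subalgebras of `FractionRing (MvPolynomial (Fin 4) k)`;
   `Cen = I(Sing_red)` as a monomial ideal via `IsJacobsonRing` + (regular ⇒ localisations regular,
   `isRegularRing_of_isRegularLocalRing`) + non-normality / embedding-dimension of the transversal
   monoids of the singular faces + smoothness of `D(χ^b)` for `b ∈ J`; the chart identity
   `B_t[J_t/χ^{b_t}] = k[S_t + ℕ(J_t − b_t)]`; the §B certificate `tU` for the recurrence; existence of
   the dominating valuation (`ValuationSubring` Zorn lemma in Mathlib).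
-/

end Summit.ResolutionOfSingularities.ResolutionOfSingularities.Cruxes.RisoCentresResolve.Disproof
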